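import Literature.MathematicalPhysics.KineticTheory.HardSphereCanonicalKSLimit
import HarnessLib

/-!
# The finite-`N` virial (contact) identity for hard spheres on `𝕋³`

Topic `Literature/MathematicalPhysics/KineticTheory`.  For `n` hard spheres of diameter `ε` on the
unit flat torus, the configurational partition function `Ξ_ε(n) = XiT ε n` (Haar measure of the
non-overlap set) is a continuous, non-increasing function of the diameter whose right derivative is
a CONTACT-SPHERE integral of the pinned partition function with one pair at contact:

  `d⁺/dε Ξ_ε(n) = −C(n,2) · 3ε² v₁ · ⟨u_ε(0, εω)(n − 2)⟩_{ω ∈ S²}`      (`hasDerivWithinAt_XiT`),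

`⟨·⟩` the normalised average over directions (written as a ball average of a function of the
direction, `contactAvg`).  Dividing by `Ξ_ε(n)` this is the finite-volume form of the virial /
contact theorem of the hard-sphere fluid, `βP/ρ = 1 + (2π/3) ρ d³ g(d⁺)` (Hansen–McDonald (2.5.26)):
the derivative of the free energy in the diameter is the contact value of the pair function.

Method: second-order inclusion–exclusion over the pairs that enter the shell `[ε, ε + h)`
(switching the pairs one at a time, `mixSet`; two simultaneous shell events cost `O(h²)`,
`volume_shell_inter_shell_le`), exchangeability, translation invariance of Haar measure, the chart
`𝕋³ ⊃ B(0, 1/2) ≅ B(0, 1/2) ⊂ ℝ³`, and the homogeneity of Lebesgue measure along rays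
(`∫_{‖u‖<b} G(u/‖u‖) du = b³ ∫_{‖u‖<1} G(u/‖u‖) du`) together with the continuity of the pinned
partition function in the position of a pinned point off contact (dominated convergence; contact
spheres are Haar-null).

## References

* J.-P. Hansen, I. R. McDonald, *Theory of Simple Liquids*, 4th ed. (2013), §2.5, (2.5.22)–(2.5.26).
  [HansenMcdonald2013]
* D. Ruelle, *Statistical Mechanics: Rigorous Results* (1969), §3.4.3, §4.2.  [Ruelle1969]
-/

noncomputable section

open MeasureTheory Set Filter Function Metric
open scoped ENNReal BigOperators Topology Classical

namespace Literature.MathematicalPhysics.KineticTheory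

open StatisticalMechanics Literature.Analysis.FluidPDE Literature.Analysis.FunctionSpaces

/-! ### Pair constraints and the hard-core set -/

/-- The set of unordered pairs of labels. [folklore] -/
def pairs2 (n : ℕ) : Finset (Finset (Fin n)) := (Finset.univ : Finset (Fin n)).powersetCard 2

/-- `|pairs2 n| = C(n, 2)`. [folklore] -/
theorem card_pairs2 (n : ℕ) : (pairs2 n).card = n.choose 2 := by
  rw [pairs2, Finset.card_powersetCard, Finset.card_univ, Fintype.card_fin]

/-- A member of `pairs2` is a pair `{a, b}` with `a ≠ b`. [folklore] -/
theorem exists_pair_of_mem_pairs2 {n : ℕ} {t : Finset (Fin n)} (ht : t ∈ pairs2 n) :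
    ∃ a b : Fin n, a ≠ b ∧ t = {a, b} := by
  rw [pairs2, Finset.mem_powersetCard] at ht
  exact Finset.card_eq_two.1 ht.2

/-- `{a, b} ∈ pairs2 n` for `a ≠ b`. [folklore] -/
theorem pair_mem_pairs2 {n : ℕ} {a b : Fin n} (hab : a ≠ b) : ({a, b} : Finset (Fin n)) ∈ pairs2 n := by
  rw [pairs2, Finset.mem_powersetCard]
  exact ⟨Finset.subset_univ _, Finset.card_pair hab⟩

/-- The pair `t` is separated at radius `r`: no two distinct labels of `t` overlap. [folklore] -/
def sepPair {n : ℕ} (r : ℝ) (t : Finset (Fin n)) : Set (Fin n → T3) :=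
  {x | ∀ i ∈ t, ∀ j ∈ t, i ≠ j → ¬ Ov r (x i) (x j)}

/-- For a genuine pair, separation is the single constraint `¬ Ov r (x a) (x b)`. [folklore] -/
theorem mem_sepPair_pair {n : ℕ} (r : ℝ) {a b : Fin n} (hab : a ≠ b) (x : Fin n → T3) :
    x ∈ sepPair r ({a, b} : Finset (Fin n)) ↔ ¬ Ov r (x a) (x b) := by
  simp only [sepPair, mem_setOf_eq, Finset.mem_insert, Finset.mem_singleton]
  constructor
  · intro h; exact h a (Or.inl rfl) b (Or.inr rfl) hab
  · intro h i hi j hj hij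
    rcases hi with rfl | rfl <;> rcases hj with rfl | rfl
    · exact absurd rfl hij
    · exact h
    · rw [not_ov_comm]; exact h
    · exact absurd rfl hij

/-- Separation is monotone in the radius. [folklore] -/
theorem sepPair_mono {n : ℕ} {r r' : ℝ} (h : r ≤ r') (t : Finset (Fin n)) :
    sepPair r' t ⊆ sepPair r t := fun _ hx i hi j hj hij hov =>
  hx i hi j hj hij (lt_of_lt_of_le hov h)

/-- `sepPair r t` is measurable. [folklore] -/
theorem measurableSet_sepPair {n : ℕ} (r : ℝ) (t : Finset (Fin n)) : MeasurableSet (sepPair r t) := by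
  have : sepPair r t = ⋂ i ∈ t, ⋂ j ∈ t, {x : Fin n → T3 | i ≠ j → ¬ Ov r (x i) (x j)} := by
    ext x; simp only [sepPair, mem_setOf_eq, mem_iInter]
  rw [this]
  refine Finset.measurableSet_biInter _ fun i _ => Finset.measurableSet_biInter _ fun j _ => ?_
  by_cases hij : i = j
  · simp [hij]
  · have : {x : Fin n → T3 | i ≠ j → ¬ Ov r (x i) (x j)} = {x | ¬ Ov r (x i) (x j)} := by
      ext x; simp [hij]
    rw [this]
    exact measurableSet_not_ov r (measurable_pi_apply i) (measurable_pi_apply j)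

/-- The hard-core (non-overlap) set of `n` labelled points at radius `e`. [folklore] -/
def hcSet (e : ℝ) (n : ℕ) : Set (Fin n → T3) := {x | ∀ i j, i ≠ j → ¬ Ov e (x i) (x j)}

/-- The pinned set with nothing pinned is the hard-core set. [folklore] -/
theorem pinnedSet_elim0 (e : ℝ) (n : ℕ) : pinnedSet e (fun i : Fin 0 => Fin.elim0 i) n = hcSet e n := by
  ext x
  simp only [pinnedSet, PinnedHC, hcSet, mem_setOf_eq]
  exact ⟨fun h => h.2.2, fun h => ⟨fun a => Fin.elim0 a, fun _ a => Fin.elim0 a, h⟩⟩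

/-- `Ξ_e(n)` is the Haar measure of the hard-core set. [folklore] -/
theorem XiT_eq_measureReal_hcSet (e : ℝ) (n : ℕ) : XiT e n = volume.real (hcSet e n) := by
  rw [XiT, pinnedXi, pinnedSet_elim0]

/-- The hard-core set is measurable. [folklore] -/
theorem measurableSet_hcSet (e : ℝ) (n : ℕ) : MeasurableSet (hcSet e n) := by
  rw [← pinnedSet_elim0]; exact measurableSet_pinnedSet _ _ _

/-- The hard-core set shrinks as the radius grows. [folklore] -/
theorem hcSet_mono {e e' : ℝ} (h : e ≤ e') (n : ℕ) : hcSet e' n ⊆ hcSet e n :=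
  fun _ hx i j hij hov => hx i j hij (lt_of_lt_of_le hov h)

/-- `Ξ` is non-increasing in the diameter. [folklore] -/
theorem XiT_antitone {e e' : ℝ} (h : e ≤ e') (n : ℕ) : XiT e' n ≤ XiT e n := by
  rw [XiT_eq_measureReal_hcSet, XiT_eq_measureReal_hcSet]
  exact measureReal_mono (hcSet_mono h n)

/-- The hard-core set is the intersection of the pair constraints. [folklore] -/
theorem mem_hcSet_iff {n : ℕ} (e : ℝ) (x : Fin n → T3) :
    x ∈ hcSet e n ↔ ∀ t ∈ pairs2 n, x ∈ sepPair e t := by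
  constructor
  · intro hx t _ i _ j _ hij; exact hx i j hij
  · intro h i j hij
    exact (mem_sepPair_pair e hij x).1 (h _ (pair_mem_pairs2 hij))

/-! ### Switching the pairs one at a time -/

/-- The interpolating sets: the pairs of `S` are separated at radius `e + h`, all pairs at radius
`e`. [folklore] -/
def mixSet (e h : ℝ) (n : ℕ) (S : Finset (Finset (Fin n))) : Set (Fin n → T3) :=
  {x | (∀ t ∈ S, x ∈ sepPair (e + h) t) ∧ x ∈ hcSet e n}

/-- `mixSet ∅ = hcSet e`. [folklore] -/
theorem mixSet_empty (e h : ℝ) (n : ℕ) : mixSet e h n ∅ = hcSet e n := by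
  ext x; simp [mixSet]

/-- `mixSet (all pairs) = hcSet (e + h)` for `h ≥ 0`. [folklore] -/
theorem mixSet_pairs2 (e : ℝ) {h : ℝ} (hh : 0 ≤ h) (n : ℕ) : mixSet e h n (pairs2 n) = hcSet (e + h) n := by
  ext x
  simp only [mixSet, mem_setOf_eq]
  rw [← mem_hcSet_iff]
  exact ⟨fun h' => h'.1, fun h' => ⟨h', hcSet_mono (by linarith) n h'⟩⟩

/-- Switching one more pair intersects with its constraint. [folklore] -/
theorem mixSet_insert (e h : ℝ) (n : ℕ) (t₀ : Finset (Fin n)) (S : Finset (Finset (Fin n))) :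
    mixSet e h n (insert t₀ S) = mixSet e h n S ∩ sepPair (e + h) t₀ := by
  ext x
  simp only [mixSet, mem_setOf_eq, Finset.mem_insert, forall_eq_or_imp, mem_inter_iff]
  tauto

/-- `mixSet S ⊆ hcSet e`. [folklore] -/
theorem mixSet_subset_hcSet (e h : ℝ) (n : ℕ) (S : Finset (Finset (Fin n))) :
    mixSet e h n S ⊆ hcSet e n := fun _ hx => hx.2

/-- `mixSet S` is measurable. [folklore] -/
theorem measurableSet_mixSet (e h : ℝ) (n : ℕ) (S : Finset (Finset (Fin n))) :
    MeasurableSet (mixSet e h n S) := by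
  have : mixSet e h n S = (⋂ t ∈ S, sepPair (e + h) t) ∩ hcSet e n := by
    ext x; simp only [mixSet, mem_setOf_eq, mem_inter_iff, mem_iInter]
  rw [this]
  exact (Finset.measurableSet_biInter _ fun t _ => measurableSet_sepPair _ t).inter
    (measurableSet_hcSet e n)

/-- The shell event of the pair `t`: separated at `e`, overlapping at `e + h`. [folklore] -/
def shellEv (e h : ℝ) (n : ℕ) (t : Finset (Fin n)) : Set (Fin n → T3) :=
  sepPair e t \ sepPair (e + h) t

/-- The contact event of the pair `t`: all pairs separated at `e`, the pair `t` overlapping at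
`e + h`. [folklore] -/
def contactEv (e h : ℝ) (n : ℕ) (t : Finset (Fin n)) : Set (Fin n → T3) :=
  hcSet e n \ sepPair (e + h) t

/-- `shellEv t` is measurable. [folklore] -/
theorem measurableSet_shellEv (e h : ℝ) (n : ℕ) (t : Finset (Fin n)) :
    MeasurableSet (shellEv e h n t) :=
  (measurableSet_sepPair e t).diff (measurableSet_sepPair _ t)

/-- `contactEv t` is measurable. [folklore] -/
theorem measurableSet_contactEv (e h : ℝ) (n : ℕ) (t : Finset (Fin n)) :
    MeasurableSet (contactEv e h n t) :=
  (measurableSet_hcSet e n).diff (measurableSet_sepPair _ t)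

/-- One switching step removes exactly the configurations of `mixSet S` in which the new pair
overlaps at `e + h`. [folklore] -/
theorem mixSet_diff_mixSet_insert (e h : ℝ) (n : ℕ) (t₀ : Finset (Fin n))
    (S : Finset (Finset (Fin n))) :
    mixSet e h n S \ mixSet e h n (insert t₀ S) = mixSet e h n S \ sepPair (e + h) t₀ := by
  rw [mixSet_insert, sdiff_self_inter]

/-- The removed set is contained in the contact event of the new pair … [folklore] -/
theorem diff_subset_contactEv (e h : ℝ) (n : ℕ) (t₀ : Finset (Fin n)) (S : Finset (Finset (Fin n))) :
    mixSet e h n S \ sepPair (e + h) t₀ ⊆ contactEv e h n t₀ :=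
  sdiff_subset_sdiff_left (mixSet_subset_hcSet e h n S)

/-- … and exhausts it up to double shell events with the pairs already switched. [folklore] -/
theorem contactEv_diff_subset (e h : ℝ) (n : ℕ) (t₀ : Finset (Fin n)) (S : Finset (Finset (Fin n)))
    (hS : S ⊆ pairs2 n) :
    contactEv e h n t₀ \ (mixSet e h n S \ sepPair (e + h) t₀) ⊆
      ⋃ t ∈ S, shellEv e h n t₀ ∩ shellEv e h n t := by
  intro x hx
  obtain ⟨⟨hxP, hxt₀⟩, hx2⟩ := hx
  have hnot : ¬ ∀ t ∈ S, x ∈ sepPair (e + h) t := fun hall => hx2 ⟨⟨hall, hxP⟩, hxt₀⟩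
  push Not at hnot
  obtain ⟨t, htS, hxt⟩ := hnot
  refine mem_biUnion htS ⟨⟨?_, hxt₀⟩, ?_, hxt⟩
  · exact fun i _ j _ hij => hxP i j hij
  · exact (mem_hcSet_iff e x).1 hxP t (hS htS)

/-- **The switching estimate**: one switching step removes the contact event of the new pair up to
the double shell events. [folklore] -/
theorem abs_measureReal_step_le (e h : ℝ) (n : ℕ) {t₀ : Finset (Fin n)} {S : Finset (Finset (Fin n))}
    (hS : S ⊆ pairs2 n) {s : ℝ}
    (hs : ∀ t ∈ S, volume.real (shellEv e h n t₀ ∩ shellEv e h n t) ≤ s) :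
    |volume.real (mixSet e h n S) - volume.real (mixSet e h n (insert t₀ S)) -
      volume.real (contactEv e h n t₀)| ≤ S.card * s := by
  have hsub : mixSet e h n (insert t₀ S) ⊆ mixSet e h n S := by
    rw [mixSet_insert]; exact inter_subset_left
  rw [← measureReal_sdiff hsub (measurableSet_mixSet e h n _), mixSet_diff_mixSet_insert]
  have hB := diff_subset_contactEv e h n t₀ S
  have hBm : MeasurableSet (mixSet e h n S \ sepPair (e + h) t₀) :=
    (measurableSet_mixSet e h n S).diff (measurableSet_sepPair _ _)
  rw [abs_sub_comm, ← measureReal_sdiff hB hBm, abs_of_nonneg measureReal_nonneg]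
  calc volume.real (contactEv e h n t₀ \ (mixSet e h n S \ sepPair (e + h) t₀))
      ≤ volume.real (⋃ t ∈ S, shellEv e h n t₀ ∩ shellEv e h n t) :=
        measureReal_mono (contactEv_diff_subset e h n t₀ S hS) (measure_ne_top _ _)
    _ ≤ ∑ t ∈ S, volume.real (shellEv e h n t₀ ∩ shellEv e h n t) := measureReal_biUnion_finset_le _ _
    _ ≤ ∑ t ∈ S, s := Finset.sum_le_sum hs
    _ = S.card * s := by rw [Finset.sum_const, nsmul_eq_mul]

/-- **Second-order inclusion–exclusion** along the switching of all pairs: if every contact event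
has measure `a` and every double shell event (of two distinct pairs) has measure `≤ s`, then
`|Ξ_e(n) − Ξ_{e+h}(n) − C(n,2) a| ≤ C(n,2)² s`. [folklore] -/
theorem abs_XiT_sub_XiT_sub_le (e : ℝ) {h : ℝ} (hh : 0 ≤ h) (n : ℕ) {a s : ℝ} (hs0 : 0 ≤ s)
    (ha : ∀ t ∈ pairs2 n, volume.real (contactEv e h n t) = a)
    (hs : ∀ t₀ ∈ pairs2 n, ∀ t ∈ pairs2 n, t₀ ≠ t →
      volume.real (shellEv e h n t₀ ∩ shellEv e h n t) ≤ s) :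
    |XiT e n - XiT (e + h) n - (n.choose 2 : ℝ) * a| ≤ (n.choose 2 : ℝ) * ((n.choose 2 : ℝ) * s) := by
  -- induction over the set of switched pairs
  have key : ∀ S : Finset (Finset (Fin n)), S ⊆ pairs2 n →
      |volume.real (hcSet e n) - volume.real (mixSet e h n S) - S.card * a| ≤
        S.card * ((pairs2 n).card * s) := by
    intro S
    induction S using Finset.induction_on with
    | empty => intro; simp [mixSet_empty]
    | @insert t₀ S ht₀ ih =>
      intro hS
      have hS' : S ⊆ pairs2 n := (Finset.subset_insert _ _).trans hS
      have ht₀P : t₀ ∈ pairs2 n := hS (Finset.mem_insert_self _ _)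
      have h1 := ih hS'
      have h2 := abs_measureReal_step_le e h n (t₀ := t₀) hS'
        (fun t ht => hs t₀ ht₀P t (hS' ht) (fun h' => ht₀ (h' ▸ ht)))
      rw [ha t₀ ht₀P] at h2
      have hcard : ((S.card : ℕ) : ℝ) * s ≤ (pairs2 n).card * s :=
        mul_le_mul_of_nonneg_right (by exact_mod_cast Finset.card_le_card hS') hs0
      rw [Finset.card_insert_of_notMem ht₀]
      push_cast
      calc |volume.real (hcSet e n) - volume.real (mixSet e h n (insert t₀ S)) - (S.card + 1) * a|
          = |(volume.real (hcSet e n) - volume.real (mixSet e h n S) - S.card * a) +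
              (volume.real (mixSet e h n S) - volume.real (mixSet e h n (insert t₀ S)) - a)| := by
            ring_nf
        _ ≤ |volume.real (hcSet e n) - volume.real (mixSet e h n S) - S.card * a| +
              |volume.real (mixSet e h n S) - volume.real (mixSet e h n (insert t₀ S)) - a| :=
            abs_add_le _ _
        _ ≤ S.card * ((pairs2 n).card * s) + S.card * s := add_le_add h1 h2
        _ ≤ S.card * ((pairs2 n).card * s) + (pairs2 n).card * s := by linarith
        _ = (S.card + 1) * ((pairs2 n).card * s) := by ring
  have := key (pairs2 n) subset_rfl
  rwa [mixSet_pairs2 e hh, card_pairs2, ← XiT_eq_measureReal_hcSet, ← XiT_eq_measureReal_hcSet] at this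

/-- **The first-order bound**: `0 ≤ Ξ_e(n) − Ξ_{e+h}(n) ≤ C(n,2) · (measure of one shell event)`.
[folklore] -/
theorem XiT_sub_XiT_le (e : ℝ) {h : ℝ} (hh : 0 ≤ h) (n : ℕ) {s₁ : ℝ}
    (hs : ∀ t ∈ pairs2 n, volume.real (shellEv e h n t) ≤ s₁) :
    XiT e n - XiT (e + h) n ≤ (n.choose 2 : ℝ) * s₁ := by
  rw [XiT_eq_measureReal_hcSet, XiT_eq_measureReal_hcSet,
    ← measureReal_sdiff (hcSet_mono (by linarith) n) (measurableSet_hcSet _ n)]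
  have hsub : hcSet e n \ hcSet (e + h) n ⊆ ⋃ t ∈ pairs2 n, shellEv e h n t := by
    intro x hx
    rw [Set.mem_sdiff, mem_hcSet_iff, mem_hcSet_iff] at hx
    obtain ⟨h1, h2⟩ := hx
    push Not at h2
    obtain ⟨t, ht, hxt⟩ := h2
    exact mem_biUnion ht ⟨h1 t ht, hxt⟩
  calc volume.real (hcSet e n \ hcSet (e + h) n) ≤ volume.real (⋃ t ∈ pairs2 n, shellEv e h n t) :=
        measureReal_mono hsub (measure_ne_top _ _)
    _ ≤ ∑ t ∈ pairs2 n, volume.real (shellEv e h n t) := measureReal_biUnion_finset_le _ _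
    _ ≤ ∑ t ∈ pairs2 n, s₁ := Finset.sum_le_sum hs
    _ = (n.choose 2 : ℝ) * s₁ := by rw [Finset.sum_const, nsmul_eq_mul, card_pairs2]

/-! ### Shell events are pair events; double shell events cost `O(h²)` -/

/-- The shell `{e ≤ dist(y, 0) < e + h}` of `𝕋³`. [folklore] -/
def shellT (e h : ℝ) : Set T3 := {y | e ≤ Torus.euclidDist y 0 ∧ Torus.euclidDist y 0 < e + h}

/-- `dist(p − q, 0) = dist(p, q)`. [folklore] -/
theorem euclidDist_sub_zero (p q : T3) : Torus.euclidDist (p - q) 0 = Torus.euclidDist p q := by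
  rw [Torus.euclidDist_eq, Torus.euclidDist_eq, sub_zero]

/-- The shell is measurable. [folklore] -/
theorem measurableSet_shellT (e h : ℝ) : MeasurableSet (shellT e h) := by
  have hc : Measurable fun y : T3 => Torus.euclidDist y 0 :=
    (continuous_euclidDist_prod.comp (continuous_id.prodMk continuous_const)).measurable
  exact (measurableSet_le measurable_const hc).inter (measurableSet_lt hc measurable_const)

/-- **The Haar measure of the shell** is at most `3 h v₁` (`0 < e`, `0 ≤ h`, `e + h < 1/2`).
[folklore] -/
theorem measureReal_shellT_le {e h : ℝ} (he : 0 < e) (hh : 0 ≤ h) (heh : e + h < 1 / 2) :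
    volume.real (shellT e h) ≤ 3 * h * v₁ := by
  have hsub : shellT e h ⊆ {y : T3 | e ≤ Torus.euclidDist y 0 ∧ Torus.euclidDist y 0 ≤ e + h} :=
    fun y hy => ⟨hy.1, hy.2.le⟩
  have h1 := Torus.volume_annulus_le (d := Fin 3) he hh heh (0 : T3)
  rw [Fintype.card_fin] at h1
  calc volume.real (shellT e h) ≤ volume.real {y : T3 | e ≤ Torus.euclidDist y 0 ∧
        Torus.euclidDist y 0 ≤ e + h} := measureReal_mono hsub (measure_ne_top _ _)
    _ ≤ (ENNReal.ofReal ((3 : ℕ) * h) * volume (ball (0 : E3) 1)).toReal := by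
        rw [measureReal_def]
        exact ENNReal.toReal_mono (ENNReal.mul_ne_top ENNReal.ofReal_ne_top
          measure_ball_lt_top.ne) h1
    _ = 3 * h * v₁ := by
        rw [ENNReal.toReal_mul, ENNReal.toReal_ofReal (by positivity), v₁]; push_cast; ring

/-- The shell event of the pair `{a, b}` is the pair event `{x_a − x_b ∈ shell}`. [folklore] -/
theorem shellEv_pair (e h : ℝ) {n : ℕ} {a b : Fin n} (hab : a ≠ b) :
    shellEv e h n {a, b} = {x | x a - x b ∈ shellT e h} := by
  ext x
  rw [shellEv, Set.mem_sdiff, mem_sepPair_pair e hab, mem_sepPair_pair (e + h) hab]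
  simp only [Ov, not_lt, not_le, shellT, mem_setOf_eq, euclidDist_sub_zero]

/-- **Integrating out a label that enters only the pair event**: for `a ≠ b`, measurable `T` and a
measurable event `E'` not involving the label `a`,
`vol({x_a − x_b ∈ T} ∩ E') = vol(T) · vol(E')`. [folklore] -/
theorem volume_pairEvent_inter {n : ℕ} {a b : Fin n} (hab : a ≠ b) {T : Set T3}
    (hT : MeasurableSet T) {E' : Set (Fin n → T3)} (hE' : MeasurableSet E')
    (hinv : ∀ x y, x ∈ E' → update x a y ∈ E') :
    volume ({x : Fin n → T3 | x a - x b ∈ T} ∩ E') = volume T * volume E' := by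
  have hE := measurableSet_pairEvent (n := n) a b hT
  have hinv' : ∀ x y, update x a y ∈ E' ↔ x ∈ E' := fun x y =>
    ⟨fun h' => by simpa using hinv _ (x a) h', hinv x y⟩
  have hvol : (volume : Measure (Fin n → T3)) = Measure.pi fun _ => volume := volume_pi
  rw [← lintegral_indicator_one (hE.inter hE'), hvol,
    lintegral_pi_eq_lintegral_update (volume : Measure T3) a (measurable_one.indicator (hE.inter hE'))]
  have hinner : ∀ x : Fin n → T3,
      ∫⁻ y, ({x : Fin n → T3 | x a - x b ∈ T} ∩ E').indicator 1 (update x a y) ∂(volume : Measure T3)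
        = E'.indicator (fun _ => volume T) x := by
    intro x
    by_cases hx : x ∈ E'
    · rw [indicator_of_mem hx]
      have hset : (fun y : T3 => ({x : Fin n → T3 | x a - x b ∈ T} ∩ E').indicator
          (1 : (Fin n → T3) → ℝ≥0∞) (update x a y)) = ((fun y : T3 => y - x b) ⁻¹' T).indicator 1 := by
        funext y
        have hmem : update x a y ∈ ({x : Fin n → T3 | x a - x b ∈ T} ∩ E') ↔
            y ∈ (fun y : T3 => y - x b) ⁻¹' T := by
          simp only [mem_inter_iff, mem_setOf_eq, update_self, update_of_ne hab.symm, hinv' x y, hx,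
            and_true, mem_preimage]
        by_cases hy : y ∈ (fun y : T3 => y - x b) ⁻¹' T
        · rw [indicator_of_mem (hmem.2 hy), indicator_of_mem hy]; rfl
        · rw [indicator_of_notMem (fun h' => hy (hmem.1 h')), indicator_of_notMem hy]
      rw [hset, lintegral_indicator_one (measurable_sub_const _ hT)]
      have hfun : (fun y : T3 => y - x b) = fun y => y + -x b := by
        funext y; rw [sub_eq_add_neg]
      rw [hfun]
      exact measure_preimage_add_right _ _ _
    · rw [indicator_of_notMem hx]
      have hzero : ∀ y, ({x : Fin n → T3 | x a - x b ∈ T} ∩ E').indicator (1 : (Fin n → T3) → ℝ≥0∞)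
          (update x a y) = 0 := fun y =>
        indicator_of_notMem (fun h' => hx ((hinv' x y).1 h'.2)) _
      simp only [hzero, lintegral_zero]
  simp_rw [hinner]
  rw [lintegral_indicator_const hE', ← hvol, mul_comm]

/-- Two distinct pairs have a label of the first outside the second. [folklore] -/
theorem exists_mem_not_mem {n : ℕ} {t₀ t : Finset (Fin n)} (ht₀ : t₀ ∈ pairs2 n) (ht : t ∈ pairs2 n)
    (hne : t₀ ≠ t) : ∃ a b : Fin n, a ≠ b ∧ t₀ = {a, b} ∧ a ∉ t := by
  obtain ⟨p, q, hpq, rfl⟩ := exists_pair_of_mem_pairs2 ht₀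
  have hcard : ({p, q} : Finset (Fin n)).card = t.card := by
    rw [Finset.card_pair hpq]
    rw [pairs2, Finset.mem_powersetCard] at ht
    exact ht.2.symm
  have hnot : ¬ ({p, q} : Finset (Fin n)) ⊆ t := fun hsub =>
    hne (Finset.eq_of_subset_of_card_le hsub hcard.ge)
  rw [Finset.insert_subset_iff, Finset.singleton_subset_iff, not_and_or] at hnot
  rcases hnot with hp | hq
  · exact ⟨p, q, hpq, rfl, hp⟩
  · exact ⟨q, p, hpq.symm, Finset.pair_comm _ _, hq⟩

/-- **Two simultaneous shell events cost `vol(shell)²`** (two distinct pairs). [folklore] -/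
theorem measureReal_shellEv_inter_le (e h : ℝ) {n : ℕ} {t₀ t : Finset (Fin n)} (ht₀ : t₀ ∈ pairs2 n)
    (ht : t ∈ pairs2 n) (hne : t₀ ≠ t) :
    volume.real (shellEv e h n t₀ ∩ shellEv e h n t) ≤ volume.real (shellT e h) ^ 2 := by
  obtain ⟨a, b, hab, rfl, hat⟩ := exists_mem_not_mem ht₀ ht hne
  obtain ⟨c, d, hcd, rfl⟩ := exists_pair_of_mem_pairs2 ht
  simp only [Finset.mem_insert, Finset.mem_singleton, not_or] at hat
  have hT := measurableSet_shellT e h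
  rw [shellEv_pair e h hab, shellEv_pair e h hcd]
  have hinv : ∀ (x : Fin n → T3) (y : T3), x ∈ {x : Fin n → T3 | x c - x d ∈ shellT e h} →
      update x a y ∈ {x : Fin n → T3 | x c - x d ∈ shellT e h} := by
    intro x y hx
    simp only [mem_setOf_eq, update_of_ne (Ne.symm hat.1), update_of_ne (Ne.symm hat.2)]
    exact hx
  have key := volume_pairEvent_inter hab hT (measurableSet_pairEvent (n := n) c d hT) hinv
  have hpair : volume {x : Fin n → T3 | x c - x d ∈ shellT e h} = volume (shellT e h) := by
    rw [show (volume : Measure (Fin n → T3)) = Measure.pi fun _ => volume from volume_pi]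
    exact pi_pairEvent_eq hcd hT
  rw [measureReal_def, key, ENNReal.toReal_mul, hpair, ← measureReal_def, sq]

/-! ### Exchangeability: all contact events have the same measure -/

/-- Relabelling by a permutation preserves the product Haar measure. [folklore] -/
theorem measurePreserving_comp_perm {n : ℕ} (τ : Equiv.Perm (Fin n)) :
    MeasurePreserving (fun x : Fin n → T3 => x ∘ τ) volume volume := by
  have hmeas : Measurable fun x : Fin n → T3 => x ∘ τ :=
    measurable_pi_lambda _ fun i => measurable_pi_apply _
  refine ⟨hmeas, ?_⟩
  rw [show (volume : Measure (Fin n → T3)) = Measure.pi fun _ => volume from volume_pi]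
  refine (Measure.pi_eq fun s hs => ?_).symm
  rw [Measure.map_apply hmeas (MeasurableSet.univ_pi hs)]
  have hpre : (fun x : Fin n → T3 => x ∘ τ) ⁻¹' Set.pi univ s = Set.pi univ fun j => s (τ.symm j) := by
    ext x
    simp only [mem_preimage, mem_univ_pi, Function.comp_apply]
    constructor
    · intro h' j; simpa using h' (τ.symm j)
    · intro h' i; simpa using h' (τ i)
  rw [hpre, Measure.pi_pi]
  exact Fintype.prod_equiv τ.symm _ _ fun j => rfl

/-- A permutation sending a given ordered pair of distinct labels to another. [folklore] -/
theorem exists_perm_pair {n : ℕ} {a b c d : Fin n} (hab : a ≠ b) (hcd : c ≠ d) :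
    ∃ τ : Equiv.Perm (Fin n), τ a = c ∧ τ b = d := by
  refine ⟨(Equiv.swap a c).trans (Equiv.swap (Equiv.swap a c b) d), ?_, ?_⟩
  · rw [Equiv.trans_apply, Equiv.swap_apply_left]
    refine Equiv.swap_apply_of_ne_of_ne ?_ hcd
    intro h'
    have : Equiv.swap a c (Equiv.swap a c b) = Equiv.swap a c c := by rw [← h']
    rw [Equiv.swap_apply_self, Equiv.swap_apply_right] at this
    exact hab this.symm
  · rw [Equiv.trans_apply, Equiv.swap_apply_left]

/-- The hard-core set is relabelling invariant. [folklore] -/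
theorem comp_perm_mem_hcSet_iff {n : ℕ} (e : ℝ) (τ : Equiv.Perm (Fin n)) (x : Fin n → T3) :
    x ∘ τ ∈ hcSet e n ↔ x ∈ hcSet e n := by
  simp only [hcSet, mem_setOf_eq, Function.comp_apply]
  constructor
  · intro h' i j hij
    have := h' (τ.symm i) (τ.symm j) (by simpa using hij)
    simpa using this
  · intro h' i j hij
    exact h' _ _ (τ.injective.ne hij)

/-- The contact event of the pair `{a, b}`. [folklore] -/
theorem contactEv_pair (e h : ℝ) {n : ℕ} {a b : Fin n} (hab : a ≠ b) :
    contactEv e h n {a, b} = hcSet e n ∩ {x | Ov (e + h) (x a) (x b)} := by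
  ext x
  rw [contactEv, Set.mem_sdiff, mem_sepPair_pair (e + h) hab, not_not, mem_inter_iff, mem_setOf_eq]

/-- **Exchangeability**: all contact events have the same measure. [folklore] -/
theorem measureReal_contactEv_eq (e h : ℝ) {n : ℕ} {t t' : Finset (Fin n)} (ht : t ∈ pairs2 n)
    (ht' : t' ∈ pairs2 n) : volume.real (contactEv e h n t') = volume.real (contactEv e h n t) := by
  obtain ⟨a, b, hab, rfl⟩ := exists_pair_of_mem_pairs2 ht
  obtain ⟨c, d, hcd, rfl⟩ := exists_pair_of_mem_pairs2 ht'
  obtain ⟨τ, hτa, hτb⟩ := exists_perm_pair hab hcd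
  have hpre : (fun x : Fin n → T3 => x ∘ τ) ⁻¹' contactEv e h n {a, b} = contactEv e h n {c, d} := by
    ext x
    rw [mem_preimage, contactEv_pair e h hab, contactEv_pair e h hcd, mem_inter_iff, mem_inter_iff,
      comp_perm_mem_hcSet_iff, mem_setOf_eq, mem_setOf_eq, Function.comp_apply, Function.comp_apply,
      hτa, hτb]
  rw [measureReal_def, measureReal_def, ← hpre, (measurePreserving_comp_perm τ).measure_preimage
    (measurableSet_contactEv e h n _).nullMeasurableSet]

/-! ### The contact event as an integral over the relative position -/

/-- **Sections along the first coordinate**: the product Haar measure of a measurable set of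
`m + 1`-point configurations is the integral of the measures of its sections at the first point.
[folklore] -/
theorem volume_eq_lintegral_cons_section {m : ℕ} {S : Set (Fin (m + 1) → T3)} (hS : MeasurableSet S) :
    volume S = ∫⁻ x₀ : T3, volume {x : Fin m → T3 | Fin.cons x₀ x ∈ S} := by
  set e := MeasurableEquiv.piFinSuccAbove (fun _ : Fin (m + 1) => T3) 0 with he
  have hm : MeasurePreserving e (volume : Measure (Fin (m + 1) → T3))
      ((volume : Measure T3).prod (volume : Measure (Fin m → T3))) :=
    volume_preserving_piFinSuccAbove (fun _ : Fin (m + 1) => T3) 0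
  have hpre : e.symm ⁻¹' S = {q : T3 × (Fin m → T3) | Fin.cons q.1 q.2 ∈ S} := by
    ext q
    have hq : e.symm q = Fin.cons q.1 q.2 := by
      rw [he, MeasurableEquiv.piFinSuccAbove_symm_apply]
      simp [Fin.insertNthEquiv, Fin.insertNth_zero']
    rw [mem_preimage, hq]; rfl
  have hS' : MeasurableSet {q : T3 × (Fin m → T3) | Fin.cons q.1 q.2 ∈ S} := by
    rw [← hpre]; exact e.symm.measurable hS
  rw [← hm.symm.measure_preimage hS.nullMeasurableSet, hpre, Measure.prod_apply hS']
  rfl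

/-- `y ↦ (y, 0)` is measurable. [folklore] -/
theorem measurable_vec2 : Measurable fun y : T3 => (![y, 0] : Fin 2 → T3) := by
  refine measurable_pi_iff.2 fun i => ?_
  refine Fin.cases ?_ (fun j => ?_) i
  · exact measurable_id
  · simp only [Matrix.cons_val_succ]
    exact measurable_const

/-- The relative-position density of the contact event (non-negative, bounded by `1`). [folklore] -/
def contactDensity (e h : ℝ) (m : ℕ) (y : T3) : ℝ :=
  (if Torus.euclidDist y 0 < e + h then (1 : ℝ) else 0) * pinnedXi e ![y, 0] m

/-- The density is measurable. [folklore] -/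
theorem measurable_contactDensity (e h : ℝ) (m : ℕ) : Measurable (contactDensity e h m) := by
  refine Measurable.mul ?_ (measurable_pinnedXi_comp e measurable_vec2 m)
  have hc : Measurable fun y : T3 => Torus.euclidDist y 0 :=
    (continuous_euclidDist_prod.comp (continuous_id.prodMk continuous_const)).measurable
  have : (fun y : T3 => if Torus.euclidDist y 0 < e + h then (1 : ℝ) else 0) =
      {y | Torus.euclidDist y 0 < e + h}.indicator 1 := by
    funext y; by_cases hy : Torus.euclidDist y 0 < e + h
    · rw [if_pos hy, indicator_of_mem (by exact hy)]; rfl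
    · rw [if_neg hy, indicator_of_notMem (by exact hy)]
  rw [this]
  exact measurable_one.indicator (measurableSet_lt hc measurable_const)

/-- `0 ≤ density ≤ 1`. [folklore] -/
theorem contactDensity_mem_Icc (e h : ℝ) (m : ℕ) (y : T3) : contactDensity e h m y ∈ Icc (0 : ℝ) 1 := by
  unfold contactDensity
  split_ifs
  · rw [one_mul]; exact ⟨pinnedXi_nonneg _ _ _, pinnedXi_le_one _ _ _⟩
  · rw [zero_mul]; exact ⟨le_rfl, zero_le_one⟩

/-- **A pair event on the hard-core set, integrated out**: peeling the two labels of the pair and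
using the translation invariance of Haar measure,
`vol(hcSet ∩ {x₁ − x₀ ∈ T}) = ∫_T u_e(y, 0)(m) dy` for every measurable `T ⊆ 𝕋³`. [folklore] -/
theorem measureReal_hcSet_inter_pairEvent (e : ℝ) (m : ℕ) {T : Set T3} (hT : MeasurableSet T) :
    volume.real (hcSet e (m + 2) ∩ {x | x 1 - x 0 ∈ T}) = ∫ y in T, pinnedXi e ![y, 0] m := by
  have hC : MeasurableSet (hcSet e (m + 2) ∩ {x : Fin (m + 2) → T3 | x 1 - x 0 ∈ T}) :=
    (measurableSet_hcSet e _).inter (measurableSet_pairEvent (n := m + 2) 1 0 hT)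
  -- the first section
  have hsec1 : ∀ (x₀ : T3) (x' : Fin (m + 1) → T3),
      Fin.cons x₀ x' ∈ hcSet e (m + 2) ∩ {x : Fin (m + 2) → T3 | x 1 - x 0 ∈ T} ↔
        x' ∈ pinnedSet e ![x₀] (m + 1) ∧ x' 0 - x₀ ∈ T := by
    intro x₀ x'
    rw [mem_inter_iff, mem_setOf_eq, Fin.cons_zero,
      show (Fin.cons x₀ x' : Fin (m + 2) → T3) 1 = x' 0 from Fin.cons_succ _ _ 0,
      ← pinnedSet_elim0, cons_mem_pinnedSet_iff e 0, Fin.insertNth_zero']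
    rfl
  -- the second section
  have hsec2 : ∀ (x₀ x₁ : T3) (x'' : Fin m → T3),
      Fin.cons x₁ x'' ∈ pinnedSet e ![x₀] (m + 1) ↔ x'' ∈ pinnedSet e ![x₁, x₀] m := by
    intro x₀ x₁ x''
    rw [cons_mem_pinnedSet_iff e 0, Fin.insertNth_zero']
    rfl
  -- the kernel after translation
  set K : T3 → ℝ≥0∞ := T.indicator fun y => ENNReal.ofReal (pinnedXi e ![y, 0] m) with hK
  have hKm : Measurable K :=
    (ENNReal.measurable_ofReal.comp (measurable_pinnedXi_comp e measurable_vec2 m)).indicator hT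
  have htrans : ∀ x₀ x₁ : T3, (if x₁ - x₀ ∈ T then volume (pinnedSet e ![x₁, x₀] m) else 0) =
      K (x₁ - x₀) := by
    intro x₀ x₁
    have hcfg : (fun a => x₀ + (![x₁ - x₀, 0] : Fin 2 → T3) a) = ![x₁, x₀] := by
      funext a
      refine Fin.cases ?_ (fun j => ?_) a
      · simp
      · fin_cases j; simp
    have hvol : volume (pinnedSet e ![x₁, x₀] m) = ENNReal.ofReal (pinnedXi e ![x₁ - x₀, 0] m) := by
      rw [← pinnedXi_const_add e x₀ ![x₁ - x₀, 0] m, hcfg, pinnedXi, measureReal_def,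
        ENNReal.ofReal_toReal (measure_ne_top _ _)]
    simp only [hK, indicator]
    by_cases hx : x₁ - x₀ ∈ T
    · rw [if_pos hx, if_pos hx, hvol]
    · rw [if_neg hx, if_neg hx]
  -- assemble
  have hstep : volume (hcSet e (m + 2) ∩ {x : Fin (m + 2) → T3 | x 1 - x 0 ∈ T}) = ∫⁻ y, K y := by
    rw [volume_eq_lintegral_cons_section hC]
    have hS1 : ∀ x₀ : T3, {x' : Fin (m + 1) → T3 | Fin.cons x₀ x' ∈ hcSet e (m + 2) ∩
        {x : Fin (m + 2) → T3 | x 1 - x 0 ∈ T}} = pinnedSet e ![x₀] (m + 1) ∩ {x' | x' 0 - x₀ ∈ T} := by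
      intro x₀; ext x'; rw [mem_setOf_eq, hsec1]; rfl
    have hS1m : ∀ x₀ : T3, MeasurableSet (pinnedSet e ![x₀] (m + 1) ∩ {x' : Fin (m + 1) → T3 |
        x' 0 - x₀ ∈ T}) := fun x₀ =>
      (measurableSet_pinnedSet e _ _).inter
        (measurableSet_preimage ((measurable_pi_apply (0 : Fin (m + 1)) :
          Measurable fun x' : Fin (m + 1) → T3 => x' 0).sub_const x₀) hT)
    simp_rw [hS1]
    have hinner : ∀ x₀ : T3, volume (pinnedSet e ![x₀] (m + 1) ∩ {x' : Fin (m + 1) → T3 |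
        x' 0 - x₀ ∈ T}) = ∫⁻ y, K y := by
      intro x₀
      rw [volume_eq_lintegral_cons_section (hS1m x₀)]
      have hS2 : ∀ x₁ : T3, {x'' : Fin m → T3 | Fin.cons x₁ x'' ∈ pinnedSet e ![x₀] (m + 1) ∩
          {x' : Fin (m + 1) → T3 | x' 0 - x₀ ∈ T}} =
            if x₁ - x₀ ∈ T then pinnedSet e ![x₁, x₀] m else ∅ := by
        intro x₁; ext x''
        simp only [mem_setOf_eq, mem_inter_iff, hsec2, Fin.cons_zero]
        split_ifs with hx <;> simp [hx]
      simp_rw [hS2]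
      have hif : ∀ x₁ : T3, volume (if x₁ - x₀ ∈ T then pinnedSet e ![x₁, x₀] m else ∅) =
          K (x₁ - x₀) := by
        intro x₁
        rw [← htrans]
        split_ifs <;> simp
      simp_rw [hif]
      exact lintegral_sub_right_eq_self K x₀
    simp_rw [hinner]
    rw [lintegral_const, measure_univ, mul_one]
  rw [measureReal_def, hstep, hK, lintegral_indicator hT, integral_eq_lintegral_of_nonneg_ae
    (Eventually.of_forall fun y => pinnedXi_nonneg e _ m)
    (measurable_pinnedXi_comp e measurable_vec2 m).aestronglyMeasurable]

/-- **The contact event integrated out**: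
`vol(contactEv {0,1}) = ∫ 𝟙[dist(y,0) < e + h] · u_e(y, 0)(m) dy`. [folklore] -/
theorem measureReal_contactEv_zero_one (e h : ℝ) (m : ℕ) :
    volume.real (contactEv e h (m + 2) {0, 1}) = ∫ y : T3, contactDensity e h m y := by
  have h01 : (0 : Fin (m + 2)) ≠ 1 := by simp
  have hc : Measurable fun y : T3 => Torus.euclidDist y 0 :=
    (continuous_euclidDist_prod.comp (continuous_id.prodMk continuous_const)).measurable
  have hT : MeasurableSet {y : T3 | Torus.euclidDist y 0 < e + h} := measurableSet_lt hc measurable_const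
  have hev : contactEv e h (m + 2) {0, 1} =
      hcSet e (m + 2) ∩ {x | x 1 - x 0 ∈ {y : T3 | Torus.euclidDist y 0 < e + h}} := by
    rw [contactEv_pair e h h01]
    congr 1
    ext x
    simp only [mem_setOf_eq, Ov, euclidDist_sub_zero, Torus.euclidDist_comm (x 1) (x 0)]
  rw [hev, measureReal_hcSet_inter_pairEvent e m hT, ← integral_indicator hT]
  refine integral_congr_ae (ae_of_all _ fun y => ?_)
  simp only [contactDensity, indicator, mem_setOf_eq]
  split_ifs <;> simp

/-! ### The chart to `ℝ³` -/

/-- The pinned partition function with the pinned pair `(proj u, 0)`, as a function of the relative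
position `u ∈ ℝ³`. [folklore] -/
def psiE (e : ℝ) (m : ℕ) (u : E3) : ℝ := pinnedXi e ![Torus.proj u, 0] m

/-- `0 ≤ ψ ≤ 1`. [folklore] -/
theorem psiE_mem_Icc (e : ℝ) (m : ℕ) (u : E3) : psiE e m u ∈ Icc (0 : ℝ) 1 :=
  ⟨pinnedXi_nonneg _ _ _, pinnedXi_le_one _ _ _⟩

/-- `ψ` is measurable. [folklore] -/
theorem measurable_psiE (e : ℝ) (m : ℕ) : Measurable (psiE e m) :=
  measurable_pinnedXi_comp e (measurable_vec2.comp Torus.measurable_proj) m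

/-- `dist(proj u, 0) = ‖u‖` for `‖u‖ < 1/2`. [folklore] -/
theorem euclidDist_proj_zero {u : E3} (hu : ‖u‖ < 1 / 2) : Torus.euclidDist (Torus.proj u) 0 = ‖u‖ := by
  rw [Torus.euclidDist_eq, sub_zero, reprSym_proj_of_norm_lt hu]

/-- **`ψ` vanishes inside the contact sphere** (the pinned pair overlaps). [folklore] -/
theorem psiE_eq_zero_of_norm_lt {e : ℝ} (m : ℕ) {u : E3} (hu : ‖u‖ < e) (hu2 : ‖u‖ < 1 / 2) :
    psiE e m u = 0 := by
  refine pinnedXi_eq_zero_of_ov e (a := 0) (b := 1) (by simp) ?_ m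
  simp only [Matrix.cons_val_zero, Matrix.cons_val_one, Ov]
  rwa [euclidDist_proj_zero hu2]

/-- **The chart**: `∫_{𝕋³} contactDensity = ∫_{‖u‖ < e + h} ψ(u) du` for `e + h < 1/2`. [folklore] -/
theorem integral_contactDensity_eq (e : ℝ) {h : ℝ} (m : ℕ) (heh : e + h < 1 / 2) :
    ∫ y : T3, contactDensity e h m y = ∫ u in ball (0 : E3) (e + h), psiE e m u := by
  have hF := measurable_contactDensity e h m
  -- pull back along the chart
  have step1 : ∫ y : T3, contactDensity e h m y =
      ∫ u in Torus.symCube (Fin 3), contactDensity e h m (Torus.proj u) := by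
    rw [← Torus.map_proj_volume_restrict_symCube (d := Fin 3),
      integral_map Torus.measurable_proj.aemeasurable hF.aestronglyMeasurable]
  -- on the cube the density is the indicator of the ball times `ψ`
  set Ψ : E3 → ℝ := (ball (0 : E3) (e + h)).indicator (psiE e m) with hΨ
  have step2 : ∫ u in Torus.symCube (Fin 3), contactDensity e h m (Torus.proj u) =
      ∫ u in Torus.symCube (Fin 3), Ψ u := by
    refine setIntegral_congr_fun Torus.measurableSet_symCube fun u hu => ?_
    have hr : Torus.euclidDist (Torus.proj u) 0 = ‖u‖ := by
      rw [Torus.euclidDist_eq, sub_zero, reprSym_proj_of_mem_symCube' hu]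
    simp only [hΨ, contactDensity, hr, indicator, mem_ball, dist_zero_right, psiE]
    split_ifs <;> simp
  -- the integrand vanishes off the cube
  have step3 : ∫ u in Torus.symCube (Fin 3), Ψ u = ∫ u, Ψ u := by
    refine setIntegral_eq_integral_of_forall_compl_eq_zero fun u hu => ?_
    simp only [hΨ]
    refine indicator_of_notMem (fun hb => hu (mem_symCube_of_norm_lt ?_)) _
    rw [mem_ball, dist_zero_right] at hb
    linarith
  rw [step1, step2, step3, hΨ, integral_indicator _root_.measurableSet_ball]

/-- The contact integral lives on the shell: `∫_{‖u‖<e+h} ψ = ∫_{e ≤ ‖u‖ < e+h} ψ`. [folklore] -/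
theorem setIntegral_ball_psiE_eq (e : ℝ) {h : ℝ} (hh : 0 ≤ h) (m : ℕ) (heh : e + h < 1 / 2) :
    ∫ u in ball (0 : E3) (e + h), psiE e m u = ∫ u in ball (0 : E3) (e + h) \ ball 0 e, psiE e m u := by
  have hint : IntegrableOn (psiE e m) (ball (0 : E3) (e + h)) :=
    Measure.integrableOn_of_bounded measure_ball_lt_top.ne (measurable_psiE e m).aestronglyMeasurable
      (M := 1) (Eventually.of_forall fun u => by
        rw [Real.norm_eq_abs, abs_of_nonneg (psiE_mem_Icc e m u).1]; exact (psiE_mem_Icc e m u).2)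
  rw [setIntegral_sdiff _root_.measurableSet_ball hint (ball_subset_ball (by linarith)), eq_comm, sub_eq_self]
  refine setIntegral_eq_zero_of_forall_eq_zero fun u hu => ?_
  rw [mem_ball, dist_zero_right] at hu
  exact psiE_eq_zero_of_norm_lt m hu (by linarith)

/-- The Lebesgue measure of the shell `{e ≤ ‖u‖ < e + h}` of `ℝ³`. [folklore] -/
theorem measureReal_ball_diff_ball {e h : ℝ} (he : 0 ≤ e) (hh : 0 ≤ h) :
    volume.real (ball (0 : E3) (e + h) \ ball 0 e) = v₁ * ((e + h) ^ 3 - e ^ 3) := by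
  have hfin : Module.finrank ℝ E3 = 3 := finrank_euclideanSpace_fin
  rw [measureReal_sdiff (ball_subset_ball (by linarith)) _root_.measurableSet_ball, measureReal_def,
    measureReal_def, Measure.addHaar_ball volume _ (by linarith : (0 : ℝ) ≤ e + h),
    Measure.addHaar_ball volume _ he, hfin, ENNReal.toReal_mul, ENNReal.toReal_mul,
    ENNReal.toReal_ofReal (by positivity), ENNReal.toReal_ofReal (by positivity), v₁]
  ring

/-! ### The basic estimates on `Ξ_e − Ξ_{e+h}` -/

/-- The measure of one shell event is the Haar measure of the shell. [folklore] -/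
theorem measureReal_shellEv (e h : ℝ) {n : ℕ} {t : Finset (Fin n)} (ht : t ∈ pairs2 n) :
    volume.real (shellEv e h n t) = volume.real (shellT e h) := by
  obtain ⟨a, b, hab, rfl⟩ := exists_pair_of_mem_pairs2 ht
  rw [shellEv_pair e h hab, measureReal_def, measureReal_def,
    show (volume : Measure (Fin n → T3)) = Measure.pi fun _ => volume from volume_pi,
    pi_pairEvent_eq hab (measurableSet_shellT e h)]

/-- **`Ξ` is Lipschitz in the diameter**: `0 ≤ Ξ_e(n) − Ξ_{e+h}(n) ≤ C(n,2) · 3 h v₁`. [folklore] -/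
theorem XiT_sub_XiT_le_mul {e h : ℝ} (he : 0 < e) (hh : 0 ≤ h) (heh : e + h < 1 / 2) (n : ℕ) :
    XiT e n - XiT (e + h) n ≤ (n.choose 2 : ℝ) * (3 * h * v₁) :=
  XiT_sub_XiT_le e hh n fun _ ht => (measureReal_shellEv e h ht).trans_le (measureReal_shellT_le he hh heh)

/-- **The second-order estimate**: for `n = m + 2` particles,
`|Ξ_e − Ξ_{e+h} − C(n,2) ∫_{‖u‖<e+h} ψ| ≤ C(n,2)² (3 h v₁)²`. [folklore] -/
theorem abs_XiT_sub_XiT_sub_integral_le {e h : ℝ} (he : 0 < e) (hh : 0 ≤ h) (heh : e + h < 1 / 2) (m : ℕ) :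
    |XiT e (m + 2) - XiT (e + h) (m + 2) -
        ((m + 2).choose 2 : ℝ) * ∫ u in ball (0 : E3) (e + h), psiE e m u| ≤
      ((m + 2).choose 2 : ℝ) * (((m + 2).choose 2 : ℝ) * (3 * h * v₁) ^ 2) := by
  have h01 : (0 : Fin (m + 2)) ≠ 1 := by simp
  rw [← integral_contactDensity_eq e m heh, ← measureReal_contactEv_zero_one]
  refine abs_XiT_sub_XiT_sub_le e hh (m + 2) (by positivity)
    (fun t ht => measureReal_contactEv_eq e h (pair_mem_pairs2 h01) ht) fun t₀ ht₀ t ht hne => ?_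
  calc volume.real (shellEv e h (m + 2) t₀ ∩ shellEv e h (m + 2) t) ≤ volume.real (shellT e h) ^ 2 :=
        measureReal_shellEv_inter_le e h ht₀ ht hne
    _ ≤ (3 * h * v₁) ^ 2 := pow_le_pow_left₀ measureReal_nonneg (measureReal_shellT_le he hh heh) 2

/-! ### The contact-sphere average and the homogeneity of Lebesgue measure along rays -/

/-- `ψ` at the contact point in the direction of `u`: a function of the direction only. [folklore] -/
def contactDir (e : ℝ) (m : ℕ) (u : E3) : ℝ := psiE e m (e • ‖u‖⁻¹ • u)

/-- `contactDir` is `0`-homogeneous. [folklore] -/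
theorem contactDir_smul (e : ℝ) (m : ℕ) {b : ℝ} (hb : 0 < b) (u : E3) :
    contactDir e m (b • u) = contactDir e m u := by
  unfold contactDir
  rcases eq_or_ne u 0 with rfl | hu
  · simp
  · have hn : ‖u‖ ≠ 0 := norm_ne_zero_iff.2 hu
    have : ‖b • u‖⁻¹ • (b • u) = ‖u‖⁻¹ • u := by
      rw [smul_smul, norm_smul, Real.norm_eq_abs, abs_of_pos hb]
      congr 1
      field_simp
    rw [this]

/-- `contactDir` is measurable. [folklore] -/
theorem measurable_contactDir (e : ℝ) (m : ℕ) : Measurable (contactDir e m) :=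
  (measurable_psiE e m).comp ((measurable_norm.inv.smul measurable_id).const_smul e)

/-- `0 ≤ contactDir ≤ 1`. [folklore] -/
theorem contactDir_mem_Icc (e : ℝ) (m : ℕ) (u : E3) : contactDir e m u ∈ Icc (0 : ℝ) 1 :=
  psiE_mem_Icc e m _

/-- **The contact-sphere average** of the pinned partition function with one pair at contact,
`⟨u_e(e ω, 0)(m)⟩_{ω ∈ S²}`, written as the normalised ball average of the direction function.
[cite: HansenMcdonald2013, §2.5 (2.5.26)] -/
def contactAvg (e : ℝ) (m : ℕ) : ℝ := v₁⁻¹ * ∫ u in ball (0 : E3) 1, contactDir e m u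

/-- `0 ≤ contactAvg ≤ 1`. [folklore] -/
theorem contactAvg_mem_Icc (e : ℝ) (m : ℕ) : contactAvg e m ∈ Icc (0 : ℝ) 1 := by
  have hv := v₁_pos
  have h0 : 0 ≤ ∫ u in ball (0 : E3) 1, contactDir e m u :=
    setIntegral_nonneg _root_.measurableSet_ball fun u _ => (contactDir_mem_Icc e m u).1
  have h1 : ∫ u in ball (0 : E3) 1, contactDir e m u ≤ v₁ := by
    have := norm_setIntegral_le_of_norm_le_const (measure_ball_lt_top (μ := (volume : Measure E3))
      (x := (0 : E3)) (r := 1))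
      (fun u _ => show ‖contactDir e m u‖ ≤ 1 by
        rw [Real.norm_eq_abs, abs_of_nonneg (contactDir_mem_Icc e m u).1]
        exact (contactDir_mem_Icc e m u).2)
    rw [Real.norm_eq_abs, abs_of_nonneg h0, one_mul] at this
    rwa [v₁, ← measureReal_def]
  constructor
  · exact mul_nonneg (inv_nonneg.2 hv.le) h0
  · rw [contactAvg, inv_mul_le_iff₀ hv, mul_one]; exact h1

/-- **Homogeneity along rays**: `∫_{‖u‖<b} contactDir = b³ · v₁ · contactAvg`. [folklore] -/
theorem setIntegral_ball_contactDir (e : ℝ) (m : ℕ) {b : ℝ} (hb : 0 < b) :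
    ∫ u in ball (0 : E3) b, contactDir e m u = b ^ 3 * (v₁ * contactAvg e m) := by
  have h1 := Measure.setIntegral_comp_smul_of_pos (volume : Measure E3) (contactDir e m) (ball (0 : E3) 1) hb
  rw [finrank_euclideanSpace_fin, smul_unitBall_of_pos hb, smul_eq_mul] at h1
  simp_rw [contactDir_smul e m hb] at h1
  rw [contactAvg, ← mul_assoc v₁, mul_inv_cancel₀ v₁_pos.ne', one_mul, h1, ← mul_assoc,
    mul_inv_cancel₀ (pow_ne_zero 3 hb.ne'), one_mul]

/-- The shell integral of the direction function. [folklore] -/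
theorem setIntegral_shell_contactDir (e : ℝ) (m : ℕ) {a b : ℝ} (ha : 0 < a) (hab : a ≤ b) :
    ∫ u in ball (0 : E3) b \ ball 0 a, contactDir e m u = (b ^ 3 - a ^ 3) * (v₁ * contactAvg e m) := by
  have hint : IntegrableOn (contactDir e m) (ball (0 : E3) b) :=
    Measure.integrableOn_of_bounded measure_ball_lt_top.ne (measurable_contactDir e m).aestronglyMeasurable
      (M := 1) (Eventually.of_forall fun u => by
        rw [Real.norm_eq_abs, abs_of_nonneg (contactDir_mem_Icc e m u).1]; exact (contactDir_mem_Icc e m u).2)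
  rw [setIntegral_sdiff _root_.measurableSet_ball hint (ball_subset_ball hab),
    setIntegral_ball_contactDir e m (ha.trans_le hab), setIntegral_ball_contactDir e m ha]
  ring

/-! ### Continuity of the pinned partition function off contact -/

/-- The pinned event of the pair `(p, 0)` in explicit form. [folklore] -/
theorem pinnedHC_vec2_iff (e : ℝ) {m : ℕ} (p : T3) (x : Fin m → T3) :
    PinnedHC e ![p, 0] x ↔ ¬ Ov e p 0 ∧ (∀ i, ¬ Ov e (x i) p ∧ ¬ Ov e (x i) 0) ∧
      ∀ i j, i ≠ j → ¬ Ov e (x i) (x j) := by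
  simp only [PinnedHC, Fin.forall_fin_two, Matrix.cons_val_zero, Matrix.cons_val_one, ne_eq,
    not_true_eq_false, false_imp_iff, true_and, and_true, zero_ne_one, one_ne_zero, not_false_eq_true,
    forall_const]
  rw [not_ov_comm e 0 p, and_self]

/-- `u ↦ dist(c, proj u)` is continuous (the chart is a local isometry). [folklore] -/
theorem continuousAt_euclidDist_proj (c : T3) (u₀ : E3) :
    ContinuousAt (fun u : E3 => Torus.euclidDist c (Torus.proj u)) u₀ := by
  rw [Metric.continuousAt_iff]
  intro ε hε
  refine ⟨min ε (1 / 2), lt_min hε (by norm_num), fun u hu => ?_⟩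
  rw [dist_eq_norm] at hu
  have hpp := euclidDist_proj_proj_of_norm_lt (hu.trans_le (min_le_right _ _))
  have t1 := euclidDist_triangle c (Torus.proj u) (Torus.proj u₀)
  have t2 := euclidDist_triangle c (Torus.proj u₀) (Torus.proj u)
  rw [Torus.euclidDist_comm (Torus.proj u₀) (Torus.proj u)] at t2
  rw [hpp] at t1 t2
  rw [Real.dist_eq, abs_lt]
  constructor <;> linarith [hu.trans_le (min_le_left _ _)]

/-- **Continuity of `ψ` off contact**: `u ↦ u_e(proj u, 0)(m)` is continuous on
`{e ≤ ‖u‖ ≤ 1/4}` (dominated convergence: the indicator of the pinned event converges off the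
Haar-null contact spheres `{dist(x_i, proj u₀) = e}`). [folklore] -/
theorem continuousOn_psiE {e : ℝ} (he : 0 < e) (m : ℕ) :
    ContinuousOn (psiE e m) {u : E3 | e ≤ ‖u‖ ∧ ‖u‖ ≤ 1 / 4} := by
  set K := {u : E3 | e ≤ ‖u‖ ∧ ‖u‖ ≤ 1 / 4} with hK
  intro u₀ hu₀
  -- the null set of configurations with a free point on the contact sphere of `proj u₀`
  set Z : Set T3 := {z | Torus.euclidDist z (Torus.proj u₀) = e} with hZ
  have hZ0 : volume Z = 0 := Torus.volume_euclidDist_eq he.ne' _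
  have hN : volume (⋃ i : Fin m, (fun x : Fin m → T3 => x i) ⁻¹' Z) = 0 := by
    refine measure_iUnion_null fun i => ?_
    rw [show (volume : Measure (Fin m → T3)) = Measure.pi fun _ => volume from volume_pi]
    exact Measure.pi_eval_preimage_null _ hZ0
  -- pointwise eventual constancy of the indicator
  have hcompat : ∀ u ∈ K, ¬ Ov e (Torus.proj u) 0 := by
    intro u hu
    rw [Ov, not_lt, euclidDist_proj_zero (by linarith [hu.2])]
    exact hu.1
  have hlim : ∀ᵐ x ∂(volume : Measure (Fin m → T3)), ∀ᶠ u in 𝓝[K] u₀,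
      x ∈ pinnedSet e ![Torus.proj u, 0] m ↔ x ∈ pinnedSet e ![Torus.proj u₀, 0] m := by
    rw [ae_iff]
    refine measure_mono_null (fun x hx => ?_) hN
    -- contrapositive: off the null set the indicator is eventually constant
    by_contra hxN
    refine hx ?_
    simp only [mem_iUnion, mem_preimage, hZ, mem_setOf_eq, not_exists] at hxN
    have hev : ∀ i : Fin m, ∀ᶠ u in 𝓝[K] u₀,
        (¬ Ov e (x i) (Torus.proj u) ↔ ¬ Ov e (x i) (Torus.proj u₀)) := by
      intro i
      have hc := continuousAt_euclidDist_proj (x i) u₀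
      rcases lt_or_gt_of_ne (hxN i) with hlt | hgt
      · have : ∀ᶠ u in 𝓝 u₀, Torus.euclidDist (x i) (Torus.proj u) < e :=
          hc.eventually (gt_mem_nhds hlt)
        refine (this.filter_mono nhdsWithin_le_nhds).mono fun u hu => ?_
        simp only [Ov, not_lt]
        exact ⟨fun h' => absurd hu (not_lt.2 h'), fun h' => absurd hlt (not_lt.2 h')⟩
      · have : ∀ᶠ u in 𝓝 u₀, e < Torus.euclidDist (x i) (Torus.proj u) :=
          hc.eventually (lt_mem_nhds hgt)
        refine (this.filter_mono nhdsWithin_le_nhds).mono fun u hu => ?_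
        simp only [Ov, not_lt]
        exact ⟨fun _ => hgt.le, fun _ => hu.le⟩
    have hall := (eventually_all.2 hev).and (eventually_mem_nhdsWithin (a := u₀) (s := K))
    refine hall.mono fun u hu => ?_
    show PinnedHC e ![Torus.proj u, 0] x ↔ PinnedHC e ![Torus.proj u₀, 0] x
    rw [pinnedHC_vec2_iff, pinnedHC_vec2_iff]
    have h1 := hcompat u hu.2
    have h2 := hcompat u₀ hu₀
    constructor
    · rintro ⟨-, hfree, hmut⟩
      exact ⟨h2, fun i => ⟨(hu.1 i).1 (hfree i).1, (hfree i).2⟩, hmut⟩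
    · rintro ⟨-, hfree, hmut⟩
      exact ⟨h1, fun i => ⟨(hu.1 i).2 (hfree i).1, (hfree i).2⟩, hmut⟩
  have hT := tendsto_measure_of_ae_tendsto_indicator_of_isFiniteMeasure (𝓝[K] u₀)
    (μ := (volume : Measure (Fin m → T3))) (measurableSet_pinnedSet e _ m)
    (fun u => measurableSet_pinnedSet e ![Torus.proj u, 0] m) hlim
  exact (ENNReal.tendsto_toReal (measure_ne_top _ _)).comp hT

/-! ### The right derivative of `Ξ` in the diameter -/

/-- The compact window on which `ψ` is uniformly continuous. [folklore] -/
theorem isCompact_window (e : ℝ) : IsCompact {u : E3 | e ≤ ‖u‖ ∧ ‖u‖ ≤ 1 / 4} := by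
  have : {u : E3 | e ≤ ‖u‖ ∧ ‖u‖ ≤ 1 / 4} = closedBall (0 : E3) (1 / 4) ∩ {u | e ≤ ‖u‖} := by
    ext u; simp only [mem_setOf_eq, mem_inter_iff, mem_closedBall, dist_zero_right]; tauto
  rw [this]
  exact (isCompact_closedBall _ _).inter_right (isClosed_le continuous_const continuous_norm)

/-- **The shell comparison**: on a thin shell `ψ` is within `κ` of its contact value along the
ray (uniform continuity with modulus `δ > h`), so
`|∫_{shell} ψ − ∫_{shell} contactDir| ≤ κ · vol(shell)`. [folklore] -/
theorem abs_setIntegral_shell_sub_le {e h δ κ : ℝ} (he : 0 < e) (hh : 0 < h) (heh : e + h ≤ 1 / 4)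
    (hhδ : h < δ) (m : ℕ)
    (hmod : ∀ u ∈ {u : E3 | e ≤ ‖u‖ ∧ ‖u‖ ≤ 1 / 4}, ∀ u' ∈ {u : E3 | e ≤ ‖u‖ ∧ ‖u‖ ≤ 1 / 4},
      dist u u' < δ → dist (psiE e m u) (psiE e m u') < κ) :
    |(∫ u in ball (0 : E3) (e + h) \ ball 0 e, psiE e m u) -
        ∫ u in ball (0 : E3) (e + h) \ ball 0 e, contactDir e m u| ≤ κ * (v₁ * ((e + h) ^ 3 - e ^ 3)) := by
  set S : Set E3 := ball (0 : E3) (e + h) \ ball 0 e with hS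
  have hSfin : volume S < ∞ := (measure_mono sdiff_subset).trans_lt measure_ball_lt_top
  have hint : ∀ {f : E3 → ℝ}, Measurable f → (∀ u, f u ∈ Icc (0 : ℝ) 1) → IntegrableOn f S := by
    intro f hf h01
    exact Measure.integrableOn_of_bounded hSfin.ne hf.aestronglyMeasurable (M := 1)
      (Eventually.of_forall fun u => by rw [Real.norm_eq_abs, abs_of_nonneg (h01 u).1]; exact (h01 u).2)
  rw [← integral_sub (hint (measurable_psiE e m) (psiE_mem_Icc e m))
    (hint (measurable_contactDir e m) (contactDir_mem_Icc e m))]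
  have hbound : ∀ u ∈ S, ‖psiE e m u - contactDir e m u‖ ≤ κ := by
    intro u hu
    rw [hS] at hu
    obtain ⟨hu1, hu2⟩ := hu
    rw [mem_ball, dist_zero_right] at hu1
    rw [mem_ball, dist_zero_right, not_lt] at hu2
    have hn0 : ‖u‖ ≠ 0 := by linarith
    have hmemu : u ∈ {u : E3 | e ≤ ‖u‖ ∧ ‖u‖ ≤ 1 / 4} := ⟨hu2, by linarith⟩
    have hnu' : ‖e • ‖u‖⁻¹ • u‖ = e := by
      rw [norm_smul, norm_smul, norm_inv, norm_norm, Real.norm_eq_abs, abs_of_pos he,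
        inv_mul_cancel₀ hn0, mul_one]
    have hmemu' : e • ‖u‖⁻¹ • u ∈ {u : E3 | e ≤ ‖u‖ ∧ ‖u‖ ≤ 1 / 4} := by
      refine ⟨by rw [hnu'], by rw [hnu']; linarith⟩
    have hdist : dist u (e • ‖u‖⁻¹ • u) < δ := by
      have hdecomp : u - e • ‖u‖⁻¹ • u = (1 - e * ‖u‖⁻¹) • u := by
        rw [smul_smul, sub_smul, one_smul]
      rw [dist_eq_norm, hdecomp, norm_smul, Real.norm_eq_abs, abs_of_nonneg, sub_mul, one_mul,
        mul_assoc, inv_mul_cancel₀ hn0, mul_one]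
      · linarith
      · rw [sub_nonneg, ← div_eq_mul_inv, div_le_one (lt_of_lt_of_le he hu2)]; exact hu2
    have := hmod u hmemu _ hmemu' hdist
    rw [Real.dist_eq] at this
    exact this.le
  have h1 := norm_setIntegral_le_of_norm_le_const hSfin hbound
  rw [Real.norm_eq_abs, hS, measureReal_ball_diff_ball he.le hh.le] at h1
  exact h1

/-- The real-arithmetic core of the derivative estimate. [folklore] -/
theorem virial_arith {e h C v A κ D a : ℝ} (he : 0 < e) (he4 : e < 1 / 4) (hh0 : 0 < h) (hh1 : h < 1)
    (hC0 : 0 ≤ C) (hv : 0 < v) (hA0 : 0 ≤ A) (hA1 : A ≤ 1) (hκ0 : 0 ≤ κ)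
    (hr₁ : |D - C * a| ≤ C * (C * (3 * h * v) ^ 2))
    (hr₂ : |a - ((e + h) ^ 3 - e ^ 3) * (v * A)| ≤ κ * (v * ((e + h) ^ 3 - e ^ 3))) :
    h⁻¹ * |D - h * (C * (3 * e ^ 2 * (v * A)))| ≤
      (C * v * (3 * e + 1) + 9 * C ^ 2 * v ^ 2) * h + 2 * C * v * κ := by
  have hsplit : D - h * (C * (3 * e ^ 2 * (v * A))) =
      (D - C * a) + C * (a - ((e + h) ^ 3 - e ^ 3) * (v * A)) + C * (v * A) * (3 * e * h ^ 2 + h ^ 3) := by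
    ring
  have hcube : (e + h) ^ 3 - e ^ 3 = h * (3 * e ^ 2 + 3 * e * h + h ^ 2) := by ring
  have habs : |D - h * (C * (3 * e ^ 2 * (v * A)))| ≤
      C * (C * (3 * h * v) ^ 2) + C * (κ * (v * ((e + h) ^ 3 - e ^ 3))) +
        C * (v * A) * (3 * e * h ^ 2 + h ^ 3) := by
    rw [hsplit]
    refine (abs_add_le _ _).trans (add_le_add ((abs_add_le _ _).trans (add_le_add hr₁ ?_)) ?_)
    · rw [abs_mul, abs_of_nonneg hC0]; exact mul_le_mul_of_nonneg_left hr₂ hC0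
    · rw [abs_of_nonneg (by positivity)]
  rw [inv_mul_le_iff₀ hh0]
  refine habs.trans ?_
  rw [hcube]
  have h2 : 3 * e ^ 2 + 3 * e * h + h ^ 2 ≤ 2 := by
    have t1 : e ^ 2 ≤ 1 / 16 := by nlinarith only [he, he4]
    have t2 : e * h ≤ 1 / 4 := by nlinarith only [he, he4, hh0, hh1]
    have t3 : h ^ 2 ≤ 1 := by nlinarith only [hh0, hh1]
    linarith only [t1, t2, t3]
  have h3 : C * (v * A) * (3 * e * h ^ 2 + h ^ 3) ≤ C * v * (3 * e + 1) * h * h := by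
    have hq : 0 ≤ 3 * e * h ^ 2 + h ^ 3 := by positivity
    have hAX : A * (3 * e * h ^ 2 + h ^ 3) ≤ (3 * e + 1) * h * h :=
      calc A * (3 * e * h ^ 2 + h ^ 3) ≤ 1 * (3 * e * h ^ 2 + h ^ 3) :=
            mul_le_mul_of_nonneg_right hA1 hq
        _ = h * h * (3 * e + h) := by ring
        _ ≤ h * h * (3 * e + 1) := mul_le_mul_of_nonneg_left (by linarith only [hh1]) (by positivity)
        _ = (3 * e + 1) * h * h := by ring
    calc C * (v * A) * (3 * e * h ^ 2 + h ^ 3) = (C * v) * (A * (3 * e * h ^ 2 + h ^ 3)) := by ring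
      _ ≤ (C * v) * ((3 * e + 1) * h * h) := mul_le_mul_of_nonneg_left hAX (by positivity)
      _ = C * v * (3 * e + 1) * h * h := by ring
  have h4 : C * (κ * (v * (h * (3 * e ^ 2 + 3 * e * h + h ^ 2)))) ≤ h * (2 * C * v * κ) :=
    calc C * (κ * (v * (h * (3 * e ^ 2 + 3 * e * h + h ^ 2))))
        = (C * κ * v * h) * (3 * e ^ 2 + 3 * e * h + h ^ 2) := by ring
      _ ≤ (C * κ * v * h) * 2 := mul_le_mul_of_nonneg_left h2 (by positivity)
      _ = h * (2 * C * v * κ) := by ring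
  have h5 : C * (C * (3 * h * v) ^ 2) = 9 * C ^ 2 * v ^ 2 * h * h := by ring
  rw [h5]
  calc 9 * C ^ 2 * v ^ 2 * h * h + C * (κ * (v * (h * (3 * e ^ 2 + 3 * e * h + h ^ 2)))) +
        C * (v * A) * (3 * e * h ^ 2 + h ^ 3)
      ≤ 9 * C ^ 2 * v ^ 2 * h * h + h * (2 * C * v * κ) + C * v * (3 * e + 1) * h * h :=
        add_le_add (add_le_add le_rfl h4) h3
    _ = h * ((C * v * (3 * e + 1) + 9 * C ^ 2 * v ^ 2) * h + 2 * C * v * κ) := by ring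

/-- The choice of the constants closes the estimate. [folklore] -/
theorem virial_arith2 {P C v ε' h : ℝ} (hP0 : 0 ≤ P) (hC0 : 0 ≤ C) (hv : 0 < v) (hε' : 0 < ε')
    (hhε : h < ε' / (2 * P + 1)) :
    P * h + 2 * C * v * (ε' / (4 * C * v + 1)) < ε' := by
  have hε1 : P * h ≤ ε' / 2 := by
    have : P * h ≤ P * (ε' / (2 * P + 1)) := mul_le_mul_of_nonneg_left hhε.le hP0
    refine this.trans ?_
    rw [mul_div_assoc', div_le_div_iff₀ (by positivity) (by norm_num)]
    nlinarith only [hP0, hε'.le]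
  have hε2 : 2 * C * v * (ε' / (4 * C * v + 1)) < ε' / 2 := by
    rw [mul_div_assoc', div_lt_div_iff₀ (by positivity) (by norm_num)]
    nlinarith only [hC0, hv, hε']
  linarith only [hε1, hε2]

/-- **The finite-`N` virial / contact identity** (right derivative of the configurational
partition function in the diameter): for `n = m + 2` hard spheres of diameter `e ∈ (0, 1/4)` on
`𝕋³`,

  `d⁺/de Ξ_e(n) = −C(n,2) · 3e² v₁ · contactAvg e m`,

where `3 v₁ · contactAvg` is the integral over the contact sphere of directions of the pinned
partition function with one pair at contact.  Divided by `Ξ_e(n)` the right side is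
`−C(n,2) 3e² v₁ ⟨v_n(contact)⟩`, the finite-volume contact value of the pair function: this is the
hard-sphere form `βP/ρ = 1 + (2π/3) ρ d³ g(d⁺)` of the virial equation at finite `N`.
[cite: HansenMcdonald2013, §2.5 (2.5.26)] -/
theorem hasDerivWithinAt_XiT {e : ℝ} (he : 0 < e) (he4 : e < 1 / 4) (m : ℕ) :
    HasDerivWithinAt (fun e' => XiT e' (m + 2))
      (-(((m + 2).choose 2 : ℝ) * (3 * e ^ 2 * (v₁ * contactAvg e m)))) (Ioi e) e := by
  set C := ((m + 2).choose 2 : ℝ) with hC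
  set A := contactAvg e m with hA
  have hC0 : 0 ≤ C := by positivity
  have hA0 : 0 ≤ A := (contactAvg_mem_Icc e m).1
  have hA1 : A ≤ 1 := (contactAvg_mem_Icc e m).2
  have hv : 0 < v₁ := v₁_pos
  have hUC := Metric.uniformContinuousOn_iff.1
    ((isCompact_window e).uniformContinuousOn_of_continuous (continuousOn_psiE he m))
  rw [hasDerivWithinAt_iff_tendsto]
  refine Metric.tendsto_nhdsWithin_nhds.2 fun ε' hε' => ?_
  set P := C * v₁ * (3 * e + 1) + 9 * C ^ 2 * v₁ ^ 2 with hP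
  have hP0 : 0 ≤ P := by positivity
  set κ := ε' / (4 * C * v₁ + 1) with hκ
  have hκ0 : 0 < κ := by positivity
  obtain ⟨δ₁, hδ₁, hmod⟩ := hUC κ hκ0
  refine ⟨min δ₁ (min (ε' / (2 * P + 1)) (min 1 (1 / 4 - e))),
    lt_min hδ₁ (lt_min (by positivity) (lt_min one_pos (by linarith only [he4]))), fun x' hx' hdx => ?_⟩
  -- the increment
  set h := x' - e with hh
  have hh0 : 0 < h := sub_pos.2 hx'
  rw [Real.dist_eq, abs_of_pos (sub_pos.2 hx')] at hdx
  have hhδ₁ : h < δ₁ := hdx.trans_le (min_le_left _ _)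
  have hhε : h < ε' / (2 * P + 1) := hdx.trans_le ((min_le_right _ _).trans (min_le_left _ _))
  have hh1 : h < 1 := hdx.trans_le ((min_le_right _ _).trans ((min_le_right _ _).trans (min_le_left _ _)))
  have hhe : h < 1 / 4 - e :=
    hdx.trans_le ((min_le_right _ _).trans ((min_le_right _ _).trans (min_le_right _ _)))
  have heh2 : e + h < 1 / 2 := by linarith only [hhe]
  have heh4 : e + h ≤ 1 / 4 := by linarith only [hhe]
  have hx'e : x' = e + h := by simp only [hh]; ring
  -- the two measure-theoretic estimates
  have hr₁ := abs_XiT_sub_XiT_sub_integral_le he hh0.le heh2 m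
  rw [setIntegral_ball_psiE_eq e hh0.le m heh2] at hr₁
  have hr₂ := abs_setIntegral_shell_sub_le he hh0 heh4 hhδ₁ m hmod
  rw [setIntegral_shell_contactDir e m he (by linarith only [hh0])] at hr₂
  -- the quantity to bound
  have hgoal : ‖x' - e‖⁻¹ * ‖XiT x' (m + 2) - XiT e (m + 2) - (x' - e) • -(C * (3 * e ^ 2 * (v₁ * A)))‖ =
      h⁻¹ * |(XiT e (m + 2) - XiT (e + h) (m + 2)) - h * (C * (3 * e ^ 2 * (v₁ * A)))| := by
    rw [hx'e, add_sub_cancel_left, Real.norm_eq_abs, abs_of_pos hh0, Real.norm_eq_abs, smul_eq_mul]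
    congr 1
    rw [← abs_neg]; congr 1; ring
  rw [Real.dist_eq, sub_zero, hgoal, abs_of_nonneg (by positivity)]
  exact (virial_arith he he4 hh0 hh1 hC0 hv hA0 hA1 hκ0.le hr₁ hr₂).trans_lt
    (virial_arith2 hP0 hC0 hv hε' hhε)

/-! ### Continuity of `Ξ` in the diameter -/

/-- **`Ξ` is Lipschitz in the diameter** on `(0, 1/2)`: `|Ξ_e(n) − Ξ_{e'}(n)| ≤ C(n,2) 3 v₁ |e − e'|`.
[folklore] -/
theorem abs_XiT_sub_XiT_le {e e' : ℝ} (he : 0 < e) (he' : 0 < e') (he2 : e < 1 / 2) (he'2 : e' < 1 / 2)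
    (n : ℕ) : |XiT e n - XiT e' n| ≤ (n.choose 2 : ℝ) * (3 * v₁) * |e - e'| := by
  wlog hle : e ≤ e' generalizing e e'
  · have := this he' he he'2 he2 (le_of_not_ge hle)
    rwa [abs_sub_comm, abs_sub_comm e' e] at this
  · have h1 := XiT_sub_XiT_le_mul he (sub_nonneg.2 hle) (by linarith) n
    rw [add_sub_cancel] at h1
    rw [abs_of_nonneg (sub_nonneg.2 (XiT_antitone hle n)), abs_of_nonpos (sub_nonpos.2 hle), neg_sub]
    calc XiT e n - XiT e' n ≤ (n.choose 2 : ℝ) * (3 * (e' - e) * v₁) := h1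
      _ = (n.choose 2 : ℝ) * (3 * v₁) * (e' - e) := by ring

/-- **`Ξ` is continuous in the diameter** on `(0, 1/2)`. [folklore] -/
theorem continuousOn_XiT (n : ℕ) : ContinuousOn (fun e => XiT e n) (Ioo 0 (1 / 2)) := by
  refine (LipschitzOnWith.of_dist_le' (K := (n.choose 2 : ℝ) * (3 * v₁)) fun e he e' he' => ?_).continuousOn
  rw [Real.dist_eq, Real.dist_eq]
  exact abs_XiT_sub_XiT_le he.1 he'.1 he.2 he'.2 n

end Literature.MathematicalPhysics.KineticTheory

end
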